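import Summits.BirchSwinnertonDyer.BirchSwinnertonDyer.Theorems.KatoDescentPotSupersingularWildUpperOptimalSharpRoadMult
import Summits.BirchSwinnertonDyer.BirchSwinnertonDyer.Theorems.KatoDescentPotSupersingularWildUpperHeegnerSharpRoad
import Summits.BirchSwinnertonDyer.BirchSwinnertonDyer.Theorems.KimAtThreeKolyvaginIsogenyTransport
import Summits.BirchSwinnertonDyer.BirchSwinnertonDyer.Theorems.SmallImageMuTransferMuTransferStubCm
import Summits.BirchSwinnertonDyer.Rank1Residual.X12.InertCoreEveryCurve
import Summits.BirchSwinnertonDyer.Rank1Residual.O6.X3WildOfKMCTorsionFreeMember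
import Literature.NumberTheory.EllipticCurves.IsogenyQuadraticTwistProofs
import HarnessLib

/-!
# Route `KatoDescentPotSupersingular` (rung K9, wild `3`, cell `bsd-potss`): the BODY of the U₀-ns node
# `WildUpperNonsurjTower` (item 19189) THROUGH THE OPTIMAL MEMBER OF THE CLASS — the ♯ rows from the two
# displayed Jetchev readings of `…WildUpperOptimalSharpRoadMult` (`q ≠ 3` A-rows in the MULTIPLICATIVE-prime form of
# referee g28's D-audit sign-off — `q ∥ N`, `3 ∤ c₃` displayed —, `q = 3` B-rows), Coates–Sujatha's (A)
# (crux 19386 `WildFineSelmerCoatesSujatha`) load-bearing only on the RESIDUE classes (Manin-dirty optimal member,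
# or two Tamagawa-`3` primes: the census C/D rows); K9 twin of `…TameUpperOptimalSharpNodes` (seat
# `bsd-potss-k8t-c4` g7, courtesy); route-free; nothing booked, no item closed, BSD is not proved by any of this

THE RE-CUT of g6's K9 node (p473967 `WildUpperHeegnerSharpRoad.wildUpperNonsurjTower_of_lower_of_rankOne_of_sharpIndexBound_of_fineSelmerManin`,
`hJ` at the row in product form for any Manin-clean datum; (A) on the Manin-dirty rows): the displayed inputs become

* `hJr` / `hJp` — the Jetchev readings of the prequel (optimal datum with `3 ∤ c`, `3`-primary `Ш`, ONE Tamagawa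
  prime, `q ≠ 3` with `q ∥ N` and `3 ∤ c₃(E)` resp. `q = 3`; additive potentially good, rank `0`, non-CM, `E[3]` irreducible, `3`-adic tower
  not onto) — census of k8t-c4 g6 (j262010): 78 A-rows (`q ≠ 3`), 58 B-rows (`q = 3`, Kodaira IV / IV*);
* `hCS` — Coates–Sujatha's (A) on the RESIDUE rows: non-CM O6 rank-`0` rows `W` (`E[3]` irreducible, tower not
  onto) whose class has an optimal member `W₀` (lattice-optimal datum `D₀` at `N_E`) with `3 ∣ c(D₀)` (Manin-dirty;
  census ∅) or with the `3`-part of `∏c_ℓ(W₀)` carried by no single bad prime (census: the 23 multi-Tamagawa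
  rows, Jetchev's Conj. 1.3 territory — or fine-unit anchors, k9-c4 g6 p482042).

THE ROAD (`wildUpperNonsurjTower_of_jetchevReadings_of_cruxAResidue`, conclusion = the BODY of 19189): at a row
`W` — CM → Burungale–Flach; otherwise take the OPTIMAL member `W₀ ∼ W` with its lattice-optimal datum `D₀`
(`X12.exists_isIsogenous_optimal`); residue rows → the fine-Selmer port of Kato 14.5 (3) + (A) AT `W`; else the
prequel AT `W₀`: `r_an`, additivity with integral `j`, CM-ness, irreducibility and TOWER non-surjectivity move
along the isogeny (`analyticRank_eq_of_isIsogenous'`, `Additive.Addv.of_isIsogenous_of_padicValRat_j_nonneg`,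
`X12.hasCM_iff_of_isIsogenous`, `exists_torsionIso_of_isIsogenous_of_irreducible` with
`GaloisImage.irr_and_not_surj_of_torsionIso` for `E[3]`, `KimAtThreeKolyvaginIsogenyTransport.towerSurjective_of_isIsogenous`
for the tower); `#Ш_an ∈ ℚ` (L₀ body AT `W`) and the twists' lower halves (`WildRankOne` at the minimal model of
`E^{(d_K)}`, an O6 row by `classO6_twist_of_heegner`) are CARRIED to `W₀` by Cassels' isogeny invariance
(`X12.exists_shaAn_eq_of_isIsogenous`, `X12.missingLowerBoundAt_of_isIsogenous`, `IsIsogenous.quadraticTwist`); the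
upper half comes back by `X12.missingUpperBoundAt_of_isIsogenous`. (`ClassO6` itself would transport — `f₃` and
`Addv` are class invariants — but is not needed at `W₀`.)

Inputs otherwise as in p473967 — the BODIES of the K9 items L₀ `WildLowerHalfRankZero` (19195), `WildRankOne`
(19200), `KatoTamagawaExactInputs` (GZK, modularity; A161″ unused), `PublishedInputsFineSelmerCM`; Gross–Zagier,
Kolyvagin, Matar–Nekovář, newforms, Bump–Friedberg–Hoffstein — plus Cassels (`bsdRHS_eq_of_isIsogenous`, held:
the route's `…CasselsRed` child). Conditional throughout; nothing asserted; NO item closed; BSD is NOT proved.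

References: [Jetchev2008] Hyp. (∗), Thm. 1.4, Cor. 1.5 (p. 3), Lemma 4.3 / 4.5 (p. 9), Rem. 6.2 (p. 15);
[MatarNekovar2019] Thm. 0.3, §0.11; [MilneADT2006] Thm. I.7.3, Rem. I.7.4; [Kato2004Asterisque] Thm. 14.5 (3);
[CoatesSujatha2005] Conj. A; [BurungaleFlach2024] Cor. 2; [CremonaAlgorithms1997] §3.9; [PastenShimura2024] §2;
[SilvermanATAEC1994] IV.9.4; [Miller2011LMS] Def. 1.1.
-/

set_option autoImplicit false
-- the Theorems directory repeats the summit name (sibling precedent `KatoDescentPotSupersingularAssembly.lean`)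
set_option linter.dupNamespace false

noncomputable section

open scoped Classical NumberField

namespace Summit.BirchSwinnertonDyer.BirchSwinnertonDyer.Theorems.WildUpperOptimalSharpNodes

open WeierstrassCurve IsDedekindDomain IsDedekindDomain.HeightOneSpectrum NumberField
  Rat.HeightOneSpectrum Literature.NumberTheory.EllipticCurves
  Literature.NumberTheory.EllipticCurves.ModularForms
  Literature.NumberTheory.DiophantineGeometry
  Literature.NumberTheory.EllipticCurves.Rank1Residual
  Literature.NumberTheory.EllipticCurves.Rank1Residual.Typed
  Literature.NumberTheory.Automorphic Literature.NumberTheory.EllipticCurves.KrizLi2019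
  Literature.NumberTheory.QuadraticFields
  Summit.BirchSwinnertonDyer.Rank1Residual
  Summit.BirchSwinnertonDyer.Rank1Residual.Additive
  Summit.BirchSwinnertonDyer.Rank1Residual.O6
  Summit.BirchSwinnertonDyer.BirchSwinnertonDyer.Theorems
  Summit.BirchSwinnertonDyer.BirchSwinnertonDyer.Theorems.WildUpperOptimalSharpRoadMult

/-! ### §1 Private re-homings (the fine-Selmer port; rationality) -/

/-- **Rank-`0` upper bound with the torsion term from the fine-Selmer reading** (private re-homing of g0's lemma,
as in the K9 sharp road): at an odd additive potentially good `p` with `E[p]` irreducible and `Y(E/ℚ^cyc)` finitely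
generated over `ℤ_p` (`hA`), `#Ш_an = q` and `ord_p #Ш ≤ ord_p q − 2 ord_p #E(ℚ)_tors`.
[cite: Kato2004Asterisque, Thm. 14.5 (3) (p. 236), Thm. 12.5 (3) (p. 222), 14.14 (p. 243), Prop. 14.16 (2) (p. 244)]
[cite: Lim2017FineSelmer, §3] [cite: Miller2011LMS, Def. 1.1] -/
private theorem padicValNat_shaOrder_le_of_katoFineSelmer_rankZero
    (hKatoA :
      Kato2004.rankZero_padicValNat_sha_add_padicValNat_tamagawa_le_of_additive_potGood_of_irreducible_of_fineSelmerDual_fg)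
    (hGZK : rank_eq_analyticRank_of_analyticRank_le_one) (hmod : hasEntireLFunction_rat)
    (W : WeierstrassCurve ℚ) [W.IsElliptic] [W.IsGloballyMinimal] (p : ℕ) [Fact p.Prime]
    (hp : p ≠ 2) (hgood : ¬ W.HasGoodReductionAtPrime p) (hmult : ¬ W.HasMultiplicativeReductionAtPrime p)
    (hpot : 0 ≤ padicValRat p W.j) (hirr : W.HasIrreducibleModPGaloisRep p)
    (hA : ∀ (κ : ZpExtension ℚ p), κ.IsCyclotomic →
      ∃ (γ : Field.absoluteGaloisGroup ℚ) (D : W.FineSelmerDualData κ γ),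
        Module.Finite ℤ_[p] (RestrictScalars ℤ_[p] (IwasawaAlgebra p) D.X))
    (hr : W.analyticRank = 0) :
    ∃ q : ℚ, shaAn W = (q : ℂ) ∧
      (padicValNat p W.shaOrder : ℤ) ≤ padicValRat p q - 2 * padicValNat p W.torsionOrder := by
  have hL : W.entireLFunction 1 ≠ 0 := (W.analyticRank_eq_zero_iff_holds (hmod W)).mp hr
  obtain ⟨hmw, hfin⟩ := hGZK W (by rw [hr]; exact zero_le_one)
  haveI : Finite W.sha := hfin
  have hmw0 : W.mordellWeilRank = 0 := by rw [hmw, hr]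
  obtain ⟨q₀, hq₀, hle⟩ := hKatoA W p hp hgood hmult hpot hirr hA hL hfin
  have hΩpos : 0 < W.realPeriodRat := W.realPeriodRat_pos_holds
  have hΩ : (W.realPeriodRat : ℂ) ≠ 0 := by exact_mod_cast hΩpos.ne'
  have hc0 : 0 < W.tamagawaProduct := W.tamagawaProduct_pos_holds
  have ht0 : 0 < W.torsionOrder := W.torsionOrder_pos_holds
  have hq₀0 : q₀ ≠ 0 := by
    rintro rfl
    rw [Rat.cast_zero, div_eq_zero_iff] at hq₀
    exact hq₀.elim hL hΩ
  refine ⟨q₀ * (W.torsionOrder : ℚ) ^ 2 / (W.tamagawaProduct : ℚ), ?_, ?_⟩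
  · have hLq : W.entireLFunction 1 = (q₀ : ℂ) * (W.realPeriodRat : ℂ) := by
      rw [← hq₀, div_mul_cancel₀ _ hΩ]
    rw [shaAn_def, W.leadingLCoeff_eq_of_analyticRank_eq_zero hr,
      W.regulator_eq_one_of_rank_zero hmw0, hLq]
    push_cast
    field_simp
  · have ht : (W.torsionOrder : ℚ) ≠ 0 := by exact_mod_cast ht0.ne'
    have hcq : (W.tamagawaProduct : ℚ) ≠ 0 := by exact_mod_cast hc0.ne'
    have hsha : padicValNat p (Nat.card (AddCommGroup.primaryComponent W.sha p)) =
        padicValNat p W.shaOrder := by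
      unfold WeierstrassCurve.shaOrder
      exact padicValNat_card_addPrimaryComponent p
    have hv : padicValRat p (q₀ * (W.torsionOrder : ℚ) ^ 2 / (W.tamagawaProduct : ℚ)) =
        padicValRat p q₀ + 2 * (padicValNat p W.torsionOrder : ℤ) -
          (padicValNat p W.tamagawaProduct : ℤ) := by
      rw [padicValRat.div (mul_ne_zero hq₀0 (pow_ne_zero 2 ht)) hcq,
        padicValRat.mul hq₀0 (pow_ne_zero 2 ht), pow_two, padicValRat.mul ht ht,
        padicValRat.of_nat, padicValRat.of_nat]
      ring
    rw [hv, ← hsha]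
    linarith

/-- **Rationality of `L(E,1)/Ω_E` from the rationality of `#Ш(E)_an` in analytic rank `0`** (`Reg = 1` by GZK;
private re-homing). [cite: Miller2011LMS, Def. 1.1] -/
private theorem exists_ratio_rat_of_shaAn_rat_rankZero (hGZK : rank_eq_analyticRank_of_analyticRank_le_one)
    (W : WeierstrassCurve ℚ) [W.IsElliptic] (hr : W.analyticRank = 0) {q : ℚ}
    (hq : shaAn W = (q : ℂ)) :
    ∃ q0 : ℚ, W.entireLFunction 1 / (W.realPeriodRat : ℂ) = (q0 : ℂ) := by
  have hmw0 : W.mordellWeilRank = 0 := by rw [(hGZK W (by rw [hr]; exact zero_le_one)).1, hr]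
  have hΩ : (W.realPeriodRat : ℂ) ≠ 0 := by exact_mod_cast W.realPeriodRat_pos_holds.ne'
  have ht : (W.torsionOrder : ℂ) ≠ 0 := by exact_mod_cast W.torsionOrder_pos_holds.ne'
  have hc : (W.tamagawaProduct : ℂ) ≠ 0 := by exact_mod_cast W.tamagawaProduct_pos_holds.ne'
  rw [shaAn_def, W.leadingLCoeff_eq_of_analyticRank_eq_zero hr, W.regulator_eq_one_of_rank_zero hmw0]
    at hq
  simp only [Complex.ofReal_one, mul_one] at hq
  refine ⟨q * W.tamagawaProduct / (W.torsionOrder : ℚ) ^ 2, ?_⟩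
  push_cast
  rw [← hq]
  field_simp

/-! ### §2 The BODY of the U₀-ns node `WildUpperNonsurjTower` through the optimal member of the class -/

/-- **The BODY of the K9 U₀-ns node `WildUpperNonsurjTower` (item 19189) from: the two JETCHEV READINGS `hJr`
(`q ≠ 3`) and `hJp` (`q = 3`) of `…WildUpperOptimalSharpRoad` (displayed schemas in the vocabulary of
`Jetchev2008.cor15_padicValNat_card_primaryComponent_sha_le`: optimal datum with `3 ∤ c`, `3`-primary `Ш`, ONE
Tamagawa prime; additive potentially good, rank `0`, non-CM, `E[3]` irreducible, `3`-adic tower not onto — NOT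
theorems of the tree, NOT asserted), the Heegner-road published facts and CASSELS' isogeny invariance,
COATES–SUJATHA'S (A) ONLY ON THE RESIDUE ROWS (`hCS`: an optimal isogenous member with `3 ∣ c`, or with the
`3`-part of `∏c_ℓ` on no single bad prime `q` — `q = 3`, or `q ≠ 3` multiplicative with `3 ∤ c₃` —), and the BODIES of the K9 items L₀ (19195), `WildRankOne` (19200),
`KatoTamagawaExactInputs`, `PublishedInputsFineSelmerCM`.** Rows: CM → Burungale–Flach; residue → the fine-Selmer
port + (A) at `W`; otherwise the prequel at the OPTIMAL member `W₀` (transports along the isogeny; rationality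
and the twists' lower halves carried from `W` by Cassels; the result carried back by Cassels). Conditional;
nothing asserted; NO item is closed; BSD is not proved by any of this.
[cite: Jetchev2008, Hypothesis (*), Thm. 1.4, Cor. 1.5 (p. 3), Lemma 4.3, 4.5 (p. 9), Rem. 6.2 (p. 15)]
[cite: MatarNekovar2019, Thm. 0.3 (p. 456), §0.11 (p. 457)] [cite: MilneADT2006, Thm. I.7.3 and Remark I.7.4]
[cite: Kato2004Asterisque, Thm. 14.5 (3) (p. 236)] [cite: CoatesSujatha2005, Conjecture A]
[cite: BurungaleFlach2024, Thm. 1.1 and Cor. 2 (p. 4)] [cite: CremonaAlgorithms1997, §3.9 (p. 87)] -/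
theorem wildUpperNonsurjTower_of_jetchevReadings_of_cruxAResidue
    (hJr : ∀ (N : ℕ) [NeZero N] (W : WeierstrassCurve ℚ) [W.IsElliptic] [W.IsGloballyMinimal]
      (K : Type) [Field K] [NumberField K],
      IsImaginaryQuadratic K → NumberField.discr K ≠ -3 → SatisfiesHeegnerHypothesis N K →
      ∀ (p : ℕ) [Fact p.Prime], p ≠ 2 → W.analyticRank = 0 → Addv W p → 0 ≤ padicValRat p W.j →
      ¬ W.HasCM → W.HasIrreducibleModPGaloisRep p → ¬ (∀ n : ℕ, W.HasSurjectiveModNGaloisRep (p ^ n : ℕ)) →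
      (∃ Dt : ModularParametrizationData W N,
        (∀ z ∈ Dt.L.lattice, ∃ w ∈ periodLattice Dt.f, z = (Dt.c : ℂ) * w) ∧ ¬ (p : ℤ) ∣ Dt.c) →
      ¬ p ∣ (W.baseChange ℚ_[p]).localTamagawaNumber ℤ_[p] →
      ∀ {P : (W.baseChange K).toAffine.Point}, IsHeegnerPoint N W K P → ¬ IsOfFinAddOrder P →
      ∀ (q : ℕ) [Fact q.Prime], q ∣ N → ¬ q ^ 2 ∣ N → q ≠ p →
      padicValNat p (Nat.card (AddCommGroup.primaryComponent (W.baseChange K).sha p)) +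
          2 * padicValNat p ((W.baseChange ℚ_[q]).localTamagawaNumber ℤ_[q]) ≤
        2 * padicValNat p (AddSubgroup.zmultiples P).index)
    (hJp : ∀ (N : ℕ) [NeZero N] (W : WeierstrassCurve ℚ) [W.IsElliptic] [W.IsGloballyMinimal]
      (K : Type) [Field K] [NumberField K],
      IsImaginaryQuadratic K → NumberField.discr K ≠ -3 → SatisfiesHeegnerHypothesis N K →
      ∀ (p : ℕ) [Fact p.Prime], p ≠ 2 → W.analyticRank = 0 → Addv W p → 0 ≤ padicValRat p W.j →
      ¬ W.HasCM → W.HasIrreducibleModPGaloisRep p → ¬ (∀ n : ℕ, W.HasSurjectiveModNGaloisRep (p ^ n : ℕ)) →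
      (∃ Dt : ModularParametrizationData W N,
        (∀ z ∈ Dt.L.lattice, ∃ w ∈ periodLattice Dt.f, z = (Dt.c : ℂ) * w) ∧ ¬ (p : ℤ) ∣ Dt.c) →
      ∀ {P : (W.baseChange K).toAffine.Point}, IsHeegnerPoint N W K P → ¬ IsOfFinAddOrder P →
      p ∣ N →
      padicValNat p (Nat.card (AddCommGroup.primaryComponent (W.baseChange K).sha p)) +
          2 * padicValNat p ((W.baseChange ℚ_[p]).localTamagawaNumber ℤ_[p]) ≤
        2 * padicValNat p (AddSubgroup.zmultiples P).index)
    (hGZ : ∀ (N : ℕ) [NeZero N] (W : WeierstrassCurve ℚ) (K : Type) [Field K] [NumberField K],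
      gross_zagier N W K)
    (hKo : ∀ (N : ℕ) [NeZero N] (W : WeierstrassCurve ℚ) (K : Type) [Field K] [NumberField K],
      kolyvagin N W K)
    (hMN : ∀ (N : ℕ) [NeZero N] (W : WeierstrassCurve ℚ) (K : Type) [Field K] [NumberField K],
      MatarNekovar2019.thm03_padicValNat_card_sha_le_of_irreducible N W K)
    (hnf : exists_isNewformOf) (hBFH : bumpFriedbergHoffstein_exists_heegnerField_split_twist_simpleZero)
    (hCassels : bsdRHS_eq_of_isIsogenous)
    (hCS : ∀ (W : WeierstrassCurve ℚ) [W.IsElliptic] [W.IsGloballyMinimal] [Fact (3 : ℕ).Prime],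
      W.analyticRank = 0 → ClassO6 W 3 → W.HasIrreducibleModPGaloisRep 3 →
      ¬ (∀ n : ℕ, W.HasSurjectiveModNGaloisRep (3 ^ n : ℕ)) → ¬ W.HasCM →
      (∃ (W₀ : WeierstrassCurve ℚ) (_ : W₀.IsElliptic) (_ : W₀.IsGloballyMinimal)
          (_ : NeZero (W₀.conductorNorm ℤ)) (D₀ : ModularParametrizationData W₀ (W₀.conductorNorm ℤ)),
        IsIsogenous W W₀ ∧ (∀ z ∈ D₀.L.lattice, ∃ w ∈ periodLattice D₀.f, z = (D₀.c : ℂ) * w) ∧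
        ((3 : ℤ) ∣ D₀.c ∨ (3 ∣ W₀.tamagawaProduct ∧
          ¬ ∃ (q : ℕ) (_ : Fact q.Prime), q ∣ W₀.conductorNorm ℤ ∧
            (q ≠ 3 → ¬ q ^ 2 ∣ W₀.conductorNorm ℤ ∧ ¬ 3 ∣ (W₀.baseChange ℚ_[3]).localTamagawaNumber ℤ_[3]) ∧
            padicValNat 3 W₀.tamagawaProduct ≤
              padicValNat 3 ((W₀.baseChange ℚ_[q]).localTamagawaNumber ℤ_[q])))) →
      ∀ (κ : ZpExtension ℚ 3), κ.IsCyclotomic →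
        ∃ (γ : Field.absoluteGaloisGroup ℚ) (Df : W.FineSelmerDualData κ γ),
          Module.Finite ℤ_[3] (RestrictScalars ℤ_[3] (IwasawaAlgebra 3) Df.X))
    (h₂ : ∀ (W : WeierstrassCurve ℚ) [W.IsElliptic] [W.IsGloballyMinimal] [Fact (3 : ℕ).Prime],
      W.analyticRank = 0 → ClassO6 W 3 → MissingLowerBoundAt W 3)
    (hR : ∀ (W : WeierstrassCurve ℚ) [W.IsElliptic] [W.IsGloballyMinimal] [Fact (3 : ℕ).Prime],
      W.analyticRank = 1 → ClassO6 W 3 → MissingPPartAt W 3)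
    (hK : Kato2004.rankZero_padicValNat_sha_add_padicValNat_tamagawa_le_of_additive_potGood_of_imageContainsSL2 ∧
      rank_eq_analyticRank_of_analyticRank_le_one ∧ WeierstrassCurve.hasEntireLFunction_rat)
    (hF : Kato2004.rankZero_padicValNat_sha_add_padicValNat_tamagawa_le_of_additive_potGood_of_irreducible_of_fineSelmerDual_fg ∧
      bsdTriple_of_hasCM_of_L_one_ne_zero) :
    ∀ (W : WeierstrassCurve ℚ) [W.IsElliptic] [W.IsGloballyMinimal] [Fact (3 : ℕ).Prime],
      W.analyticRank = 0 → ClassO6 W 3 → W.HasIrreducibleModPGaloisRep 3 →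
      ¬ (∀ n : ℕ, W.HasSurjectiveModNGaloisRep (3 ^ n : ℕ)) → MissingUpperBoundAt W 3 := by
  obtain ⟨-, hGZK, hmod⟩ := hK
  intro W _ _ _ hr hO hI hnsT
  haveI : NeZero (W.conductorNorm ℤ) := ⟨(conductorNorm_pos_holds W).ne'⟩
  have hp2 : (3 : ℕ) ≠ 2 := hO.1
  have hadd : Addv W 3 := hO.2.1
  have hj : 0 ≤ padicValRat 3 W.j := hO.padicValRat_j_nonneg
  -- CM rows: Burungale–Flach
  by_cases hcm : W.HasCM
  · haveI : Finite W.sha := (hGZK W (by rw [hr]; exact zero_le_one)).2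
    exact (lower_and_upper_of_missingPPartAt W 3 (missingPPartAt_of_bsdp W 3
      (Summit.BirchSwinnertonDyer.Rank1Residual.bsdp_cm_rankZero hF.2 hmod hcm hr))).2
  -- the optimal member of the class and its lattice-optimal datum (Modularity)
  obtain ⟨W₀, hE₀, hM₀, hNZ₀, D₀, hiso, hN, hopt⟩ := X12.exists_isIsogenous_optimal hnf W
  -- the residue rows: the fine-Selmer port + (A) at `W`
  by_cases hres : (3 : ℤ) ∣ D₀.c ∨ (3 ∣ W₀.tamagawaProduct ∧
      ¬ ∃ (q : ℕ) (_ : Fact q.Prime), q ∣ W₀.conductorNorm ℤ ∧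
        (q ≠ 3 → ¬ q ^ 2 ∣ W₀.conductorNorm ℤ ∧ ¬ 3 ∣ (W₀.baseChange ℚ_[3]).localTamagawaNumber ℤ_[3]) ∧
        padicValNat 3 W₀.tamagawaProduct ≤ padicValNat 3 ((W₀.baseChange ℚ_[q]).localTamagawaNumber ℤ_[q]))
  · obtain ⟨q, hq, hle⟩ := padicValNat_shaOrder_le_of_katoFineSelmer_rankZero hF.1 hGZK hmod W 3 hp2 hadd.1
      hadd.2 hj hI (hCS W hr hO hI hnsT hcm ⟨W₀, hE₀, hM₀, hNZ₀, D₀, hiso, hopt, hres⟩) hr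
    refine ⟨q, hq, ?_⟩
    rw [padicValNat_torsionOrder_eq_zero_of_irreducible W 3 hI] at hle
    simpa using hle
  have hc₀ : ¬ (3 : ℤ) ∣ D₀.c := fun h ↦ hres (Or.inl h)
  have hsingle₀ : 3 ∣ W₀.tamagawaProduct → ∃ (q : ℕ) (_ : Fact q.Prime), q ∣ W₀.conductorNorm ℤ ∧
      (q ≠ 3 → ¬ q ^ 2 ∣ W₀.conductorNorm ℤ ∧ ¬ 3 ∣ (W₀.baseChange ℚ_[3]).localTamagawaNumber ℤ_[3]) ∧
      padicValNat 3 W₀.tamagawaProduct ≤ padicValNat 3 ((W₀.baseChange ℚ_[q]).localTamagawaNumber ℤ_[q]) := by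
    intro ht
    by_contra hne
    exact hres (Or.inr ⟨ht, hne⟩)
  -- transports along `W ∼ W₀`: analytic rank, additivity with integral `j`, CM, `E[3]`, the `3`-adic tower
  have hr₀ : W₀.analyticRank = 0 := by rw [← analyticRank_eq_of_isIsogenous' hiso]; exact hr
  obtain ⟨hadd₀, hj₀⟩ := Addv.of_isIsogenous_of_padicValRat_j_nonneg (p := 3) hadd hj hiso
  obtain ⟨e, he⟩ :=
    Summit.BirchSwinnertonDyer.BirchSwinnertonDyer.Rank1Residual.exists_torsionIso_of_isIsogenous_of_irreducible
      (p := 3) hI hiso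
  have hI₀ : W₀.HasIrreducibleModPGaloisRep 3 :=
    GreenbergVatsal2000.hasIrreducibleModPGaloisRep_of_torsionIso e he hI
  have hns₀ : ¬ (∀ n : ℕ, W₀.HasSurjectiveModNGaloisRep (3 ^ n : ℕ)) := fun h ↦
    hnsT (KimAtThreeKolyvaginIsogenyTransport.towerSurjective_of_isIsogenous hiso.symm_of_charZero h)
  have hcm₀ : ¬ W₀.HasCM := fun h ↦ hcm ((X12.hasCM_iff_of_isIsogenous hiso).mpr h)
  -- rationality of `L(E₀,1)/Ω`: `#Ш_an(E) ∈ ℚ` from the L₀ body at `W`, moved by Cassels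
  obtain ⟨q, hq, -⟩ := h₂ W hr hO
  have hfinW : Finite W.sha := (hGZK W (by rw [hr]; exact zero_le_one)).2
  have hleadW : W.leadingLCoeff ≠ 0 := W.leadingLCoeff_ne_zero_holds (hmod W)
  obtain ⟨q', hq', -⟩ := X12.exists_shaAn_eq_of_isIsogenous hCassels hiso.symm_of_charZero hfinW hleadW 3 hq
  have hrat₀ := exists_ratio_rat_of_shaAn_rat_rankZero hGZK W₀ hr₀ hq'
  -- the twists' lower halves: `WildRankOne` at the minimal model of `E^{(d_K)}` (an O6 row), moved by Cassels
  have hlow₀ : ∀ (K : Type) [Field K] [NumberField K], IsImaginaryQuadratic K →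
      SatisfiesHeegnerHypothesis (W₀.conductorNorm ℤ) K → Odd (NumberField.discr K) →
      ∀ (Wd : WeierstrassCurve ℚ) [Wd.IsElliptic] [Wd.IsGloballyMinimal] (Cd : VariableChange ℚ),
        Cd • W₀.quadraticTwist (NumberField.discr K : ℚ) = Wd → Wd.analyticRank = 1 →
        MissingLowerBoundAt Wd 3 := by
    intro K _ _ hKq hHN₀ hodd Wd₀ _ _ Cd₀ hWd₀ hrd₀
    have hHN : SatisfiesHeegnerHypothesis (W.conductorNorm ℤ) K := by rw [← hN]; exact hHN₀
    have hD0 : (NumberField.discr K : ℚ) ≠ 0 := by exact_mod_cast NumberField.discr_ne_zero K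
    haveI : (W.quadraticTwist (NumberField.discr K : ℚ)).IsElliptic := W.isElliptic_quadraticTwist hD0
    haveI : (W₀.quadraticTwist (NumberField.discr K : ℚ)).IsElliptic := W₀.isElliptic_quadraticTwist hD0
    obtain ⟨Cd, hCd⟩ := hasGlobalMinimalModel_rat_holds (W.quadraticTwist (NumberField.discr K : ℚ))
    haveI : (Cd • W.quadraticTwist (NumberField.discr K : ℚ)).IsGloballyMinimal := hCd
    obtain ⟨hOd, -⟩ := classO6_twist_of_heegner W hO K hKq hHN hodd
      (Cd • W.quadraticTwist (NumberField.discr K : ℚ)) Cd rfl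
    haveI : NeZero (2 : ℚ) := ⟨two_ne_zero⟩
    have hisoT : IsIsogenous (Cd • W.quadraticTwist (NumberField.discr K : ℚ)) Wd₀ := by
      rw [← hWd₀]
      exact IsIsogenous.trans' (IsIsogenous.trans' (isIsogenous_of_smul _ Cd) (hiso.quadraticTwist hD0))
        (isIsogenous_smul _ Cd₀)
    have hrd : (Cd • W.quadraticTwist (NumberField.discr K : ℚ)).analyticRank = 1 := by
      rw [analyticRank_eq_of_isIsogenous' hisoT]; exact hrd₀
    have hlowd : MissingLowerBoundAt (Cd • W.quadraticTwist (NumberField.discr K : ℚ)) 3 :=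
      (lower_and_upper_of_missingPPartAt _ 3 (hR _ hrd hOd)).1
    have hfind : Finite (Cd • W.quadraticTwist (NumberField.discr K : ℚ)).sha :=
      (hGZK _ (by rw [hrd])).2
    have hleadd : (Cd • W.quadraticTwist (NumberField.discr K : ℚ)).leadingLCoeff ≠ 0 :=
      (Cd • W.quadraticTwist (NumberField.discr K : ℚ)).leadingLCoeff_ne_zero_holds (hmod _)
    exact X12.missingLowerBoundAt_of_isIsogenous hCassels hisoT.symm_of_charZero hfind hleadd hlowd
  -- the upper half at the optimal member, then back to `W` by Cassels
  have hup₀ : MissingUpperBoundAt W₀ 3 :=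
    missingUpperBoundAt_rankZero_of_optimalDatum_of_jetchevReadingsMult hGZ hKo hMN hGZK hmod hnf hBFH hJr hJp W₀ 3
      hr₀ hp2 hadd₀ hj₀ hcm₀ hI₀ hns₀ D₀ hopt hc₀ hsingle₀ hrat₀ hlow₀
  have hfin₀ : Finite W₀.sha := (hGZK W₀ (by rw [hr₀]; exact zero_le_one)).2
  have hlead₀ : W₀.leadingLCoeff ≠ 0 := W₀.leadingLCoeff_ne_zero_holds (hmod W₀)
  exact X12.missingUpperBoundAt_of_isIsogenous hCassels hiso hfin₀ hlead₀ hup₀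

end Summit.BirchSwinnertonDyer.BirchSwinnertonDyer.Theorems.WildUpperOptimalSharpNodes

end
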